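import Summits.QuantumFields.YangMills.Theorems.BalabanUVNodesN15CovariantAveragingDefect
import HarnessLib

/-!
# N15 = NE2, road (c) — PROGRAMME (PC), towards (PC-E): THE TWO-GRID η-DEFECT OF THE AVERAGING PERTURBATION FOR ABSTRACT PATH KERNELS — n15-c∕186 `hasMaj_idef_nvQ` with `cvaPath T`,
# `cvaPath T′` replaced by kernels `W, W′` given only through row∕column bounds and the two-grid kernel fits (dag-n15-c g30, n15-c∕325)

Cell `pub-ymgap`, seat `pub-ymgap-dag-n15-c` (generation g30; R134 (a), s1; HUMAN RULING D-0062).  `bears_on: R4∕N15 · K3⁸ SpineGivenEndpointR13SepCoPHV (stmt-QuantumFields-27366)`;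
filed `--kind proof --supports stmt-QuantumFields-27366 --as helper` — COUNT-NEUTRAL.  ONE theorem, 0 `def`, 0 `sorry`; the proof text of n15-c∕186 VERBATIM with the transporter-specific
row lemmas (`rows_cvaPath_le`, `hasMaj_qvCov`, …) replaced by their kernel-generic parents (n15-c∕182 `hasMaj_qvKer`∕`hasMaj_qvAdjKer`, n15-c∕184a∕184b `hasMaj_qvKer_twoGrid`∕
`hasMaj_qvAdjKer_twoGrid`).  Imports BY NAME n15-c∕186 `…CovariantAveragingDefect` (for `idef_pull_id_eq`, `idef_id_pull_eq`, `hasMaj_twoGrid_flat(Adj)`).  Nothing in the tree is modified.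

WHY (HOME HANDOFF §g30, (PC-E) pairing-independent bricks).  The per-cube two-grid row of `N_V^Q` needs n15-c∕186 for transporters that are small only NEAR the cut.  Extending the FIELDS
by `𝟙` breaks the two-grid fit on paths crossing the extension boundary; extending the PATH KERNELS instead (`W̃ := cvaPath T` on paths whose two blocks lie in the data region, `:= 1`
elsewhere — the SAME criterion for the paired coarse and fine paths) keeps the fit (`0` outside) and the row bounds, and the cut word is unchanged.  For that the defect lemma must accept
ABSTRACT kernels: this file.

WHAT.  ★★ `hasMaj_idef_nvKer` — coarse kernel `W` with rows and columns `≤ 1 + K`, fine kernel `W′` with columns `≤ 1 + K′`, two-grid kernel fits `φ` (average and adjoint shapes), `δ > 0`: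
`idef P̂ P̂ (a·(Q′*Q′ ⊗ 1 − Q*_{W′}Q_{W′})) (a·(Q*Q ⊗ 1 − Q*_WQ_W)) ≤ |a|·c_{d+1}(δ)e^{3δ}·(4∕L^k + (φ + 2(1+K)∕L^k)(2 + K + K′))·e^{−δ|y−y′|_T}` (186's constant with `K, K′` abstract).

HONEST FRAMING ∕ LIMITS.  Kernel bookkeeping on MODEL carriers (as n15-c∕186); [King1986] Prop. 3.9 p.665 and [B9] (3.59)–(3.60) p.402 cited for SHAPES only.  NE2⁺ NOT PRINTED, NOT proved;
N15 of record untouched (DISCHARGED AS CONSUMED, p687738); K3⁸ OPEN; counts UNMOVED (typed 28∕28); one finite 𝕋⁴ at fixed ε per index — NOT infinite volume, NOT OS on ℝ⁴, NOT a mass gap,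
NOT Clay.  Restate-immune (no Theses import).
-/

noncomputable section

open scoped BigOperators Matrix
open Finset

namespace Summit.QuantumFields.YangMills.BalabanUVNodes.N15.CovAvg

open Literature.MathematicalPhysics.QuantumFieldTheory.Balaban1983to89
open Literature.MathematicalPhysics.QuantumFieldTheory.Balaban1983to89.B11SectG (BlockNorm HasMaj RowSum hasMaj_comp_exp)
open Literature.MathematicalPhysics.QuantumFieldTheory.Balaban1983to89.B5Prop11Plancherel (Tor fine unitVec)
open Literature.MathematicalPhysics.QuantumFieldTheory.Balaban1983to89.B6UnitTorusCarrier (unitTorusGeo triangle254_unitTorusGeo rowSum_unitTorusGeo unitTorusGeo_dist_nonneg unitTorusGeo_dist)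
open Literature.MathematicalPhysics.QuantumFieldTheory.Balaban1983to89.T4EtaRateDefect (idef idef_comp idef_sub idef_smul)
open Literature.MathematicalPhysics.QuantumFieldTheory.Balaban1983to89.T4EtaRateCoeffDefect (pull pull_apply)
open Literature.MathematicalPhysics.QuantumFieldTheory.King1986.Torus (blockOf tdistT tdistT_nonneg)
open Summit.QuantumFields.YangMills.BalabanUVNodes.N15.VectorPiece (kingPr kingPrV tensorId)
open Summit.QuantumFields.YangMills.BalabanUVNodes.N15.MatrixSpecies (liftMap liftBlk)
open Summit.QuantumFields.YangMills.BalabanUVNodes.N15.TwoGrid (qvRe qvAdjRe hasMaj_smul_ofBlocks)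

variable {d : ℕ}

section Defect

variable {L : ℕ} [NeZero L] (M : Fin (d + 1) → ℕ) [∀ μ, NeZero (M μ)] (k m : ℕ) {ι : Type} [Fintype ι] [DecidableEq ι]

/-- ★★ **THE TWO-GRID η-DEFECT OF THE AVERAGING PERTURBATION — KERNEL-GENERIC EDITION of n15-c∕186 `hasMaj_idef_nvQ`.**  Coarse path kernel `W` (level `L^k`) with rows AND
columns `≤ 1 + K`, fine kernel `W′` (level `L^mL^k`) with columns `≤ 1 + K′`, and the two-grid kernel fits of n15-c∕184a∕184b for `(W′, W)` in rows and columns (`φ`); `δ > 0`.  Then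
`idef P̂ P̂ (a·(Q′*Q′ ⊗ 1 − Q*_{W′}Q_{W′})) (a·(Q*Q ⊗ 1 − Q*_WQ_W)) ≤ |a|·c_{d+1}(δ)·e^{3δ}·(4∕L^k + (φ + 2(1+K)∕L^k)·(2 + K + K′))·e^{−δ|y−y′|_T}` from coarse coloured 1-forms into fine ones
(186's proof text with `hasMaj_qvKer`∕`hasMaj_qvAdjKer`∕`hasMaj_qvKer_twoGrid`∕`hasMaj_qvAdjKer_twoGrid` fed the abstract bounds).
[cite: King1986, Prop. 3.9 (3.73) p.665 (shape of the η-rate); Balaban1985BackgroundPropagators, (3.59)–(3.60) p.402 (the averaging words)] -/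
theorem hasMaj_idef_nvKer {W : Tor (fine (L ^ k) M) × Fin (d + 1) → ℕ → Matrix ι ι ℝ} {W' : Tor (fine (L ^ m * L ^ k) M) × Fin (d + 1) → ℕ → Matrix ι ι ℝ}
    {K K' φ δ : ℝ} (hK : 0 ≤ K) (hK' : 0 ≤ K') (hφ : 0 ≤ φ) (hδ : 0 < δ)
    (hWr : ∀ p s, s ≤ L ^ k → ∀ i, ∑ c, |W p s i c| ≤ 1 + K) (hWc : ∀ p s, s ≤ L ^ k → ∀ c, ∑ i, |W p s i c| ≤ 1 + K)
    (hW'c : ∀ p s, s ≤ L ^ m * L ^ k → ∀ c, ∑ i, |W' p s i c| ≤ 1 + K')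
    (hfit : ∀ (x' : Tor (fine (L ^ m * L ^ k) M)) (μ : Fin (d + 1)) (s j δ' : ℕ), s < L ^ k → j < L ^ m → δ' ≤ 1 →
      kingPr L k m M (x' + j • unitVec (fine (L ^ m * L ^ k) M) μ) = kingPr L k m M x' + δ' • unitVec (fine (L ^ k) M) μ →
      ∀ i, ∑ c, |(W' (x', μ) (L ^ m * s + j) - W (kingPr L k m M x', μ) (s + δ')) i c| ≤ φ)
    (hfitA : ∀ (x' : Tor (fine (L ^ m * L ^ k) M)) (κ : Fin (d + 1)) (s j δ' : ℕ), s < L ^ k → j < L ^ m → δ' ≤ 1 →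
      kingPr L k m M (x' - j • unitVec (fine (L ^ m * L ^ k) M) κ) = kingPr L k m M x' - δ' • unitVec (fine (L ^ k) M) κ →
      ∀ c, ∑ i, |(W' (x' - (L ^ m * s + j) • unitVec (fine (L ^ m * L ^ k) M) κ, κ) (L ^ m * s + j) -
        W (kingPr L k m M x' - (s + δ') • unitVec (fine (L ^ k) M) κ, κ) (s + δ')) i c| ≤ φ) (a : ℝ) :
    HasMaj (BlockNorm.ofBlocks (unitTorusGeo L k M) (liftBlk (fun b : Tor (fine (L ^ k) M) × Fin (d + 1) => blockOf (L ^ k) M b.1) ι))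
      (BlockNorm.ofBlocks (unitTorusGeo L k M) (liftBlk (fun b : Tor (fine (L ^ m * L ^ k) M) × Fin (d + 1) => blockOf (L ^ m * L ^ k) M b.1) ι))
      (idef (pull (liftMap (kingPrV L k m M) ι)) (pull (liftMap (kingPrV L k m M) ι))
        (a • (tensorId ι (qvAdjRe M (L ^ m * L ^ k) ∘ₗ qvRe M (L ^ m * L ^ k)) - qvAdjKer M (L ^ m * L ^ k) W' ∘ₗ qvKer M (L ^ m * L ^ k) W'))
        (a • (tensorId ι (qvAdjRe M (L ^ k) ∘ₗ qvRe M (L ^ k)) - qvAdjKer M (L ^ k) W ∘ₗ qvKer M (L ^ k) W)))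
      (fun y y' => |a| * (B4Sect5Proof.latticeConst (d + 1) δ * Real.exp (3 * δ)) *
        (4 / (L ^ k : ℕ) + (φ + 2 * (1 + K) / (L ^ k : ℕ)) * (2 + K + K')) *
        Real.exp (-(δ * tdistT M y y'))) := by
  -- constants
  set c : ℝ := B4Sect5Proof.latticeConst (d + 1) δ with hcdef
  have hc : 0 ≤ c := B4Sect5Proof.latticeConst_nonneg (d + 1) hδ.le
  have hrow : RowSum (unitTorusGeo L k M) δ c := rowSum_unitTorusGeo L k M hδ
  have h2δ : (0 : ℝ) ≤ 2 * δ := by linarith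
  have hn0 : (0 : ℝ) ≤ 2 / (L ^ k : ℕ) := by positivity
  have hB : 0 ≤ φ + 2 * (1 + K) / (L ^ k : ℕ) := by positivity
  -- the flat pair is the covariant pair at `T ≡ 1`
  have hflat : ∀ (n : ℕ) [NeZero n], tensorId ι (qvAdjRe M n ∘ₗ qvRe M n) = qvCovAdj M n (fun _ _ => (1 : Matrix ι ι ℝ)) ∘ₗ qvCov M n (fun _ _ => (1 : Matrix ι ι ℝ)) :=
    fun n _ => by rw [cva_tensorId_comp, qvCov_one, qvCovAdj_one]
  rw [hflat (L ^ k), hflat (L ^ m * L ^ k), idef_smul, idef_sub,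
    idef_comp (τ₂ := (LinearMap.id : ((Tor M × Fin (d + 1)) × ι → ℝ) →ₗ[ℝ] ((Tor M × Fin (d + 1)) × ι → ℝ))),
    idef_comp (τ₂ := (LinearMap.id : ((Tor M × Fin (d + 1)) × ι → ℝ) →ₗ[ℝ] ((Tor M × Fin (d + 1)) × ι → ℝ))),
    idef_pull_id_eq, idef_pull_id_eq, idef_id_pull_eq, idef_id_pull_eq]
  -- the four inner defects and the four outer factors
  have hD1 := hasMaj_twoGrid_flat (L := L) M k m (ι := ι) hδ.le
  have hD2 := hasMaj_twoGrid_flatAdj (L := L) M k m (ι := ι) h2δ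
  have hD3 : HasMaj (BlockNorm.ofBlocks (unitTorusGeo L k M) (liftBlk (fun b : Tor (fine (L ^ k) M) × Fin (d + 1) => blockOf (L ^ k) M b.1) ι))
      (BlockNorm.ofBlocks (unitTorusGeo L k M) (liftBlk (fun b : Tor M × Fin (d + 1) => b.1) ι))
      (qvKer M (L ^ m * L ^ k) W' ∘ₗ pull (liftMap (kingPrV L k m M) ι) - qvKer M (L ^ k) W)
      (fun y y' => (φ + 2 * (1 + K) / (L ^ k : ℕ)) * Real.exp δ * Real.exp (-(δ * tdistT M y y'))) :=
    hasMaj_qvKer_twoGrid M k m (by positivity) hφ hδ.le hWr hfit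
  have hD4 : HasMaj (BlockNorm.ofBlocks (unitTorusGeo L k M) (liftBlk (fun b : Tor M × Fin (d + 1) => b.1) ι))
      (BlockNorm.ofBlocks (unitTorusGeo L k M) (liftBlk (fun b : Tor (fine (L ^ m * L ^ k) M) × Fin (d + 1) => blockOf (L ^ m * L ^ k) M b.1) ι))
      (qvAdjKer M (L ^ m * L ^ k) W' - pull (liftMap (kingPrV L k m M) ι) ∘ₗ qvAdjKer M (L ^ k) W)
      (fun y y' => (φ + 2 * (1 + K) / (L ^ k : ℕ)) * Real.exp (2 * δ) * Real.exp (-(2 * δ * tdistT M y y'))) :=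
    hasMaj_qvAdjKer_twoGrid M k m (by positivity) hφ h2δ hWc hfitA
  have hQ1 : HasMaj (BlockNorm.ofBlocks (unitTorusGeo L k M) (liftBlk (fun b : Tor (fine (L ^ k) M) × Fin (d + 1) => blockOf (L ^ k) M b.1) ι))
      (BlockNorm.ofBlocks (unitTorusGeo L k M) (liftBlk (fun b : Tor M × Fin (d + 1) => b.1) ι))
      (qvCov M (L ^ k) (fun _ _ => (1 : Matrix ι ι ℝ))) (fun y y' => 1 * Real.exp δ * Real.exp (-(δ * tdistT M y y'))) := by
    have h := hasMaj_qvCov (L := L) M k (L ^ k) (T := fun _ _ => (1 : Matrix ι ι ℝ)) (ρ := 0) le_rfl hδ.le (fun μ p i => by simp)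
    simpa only [add_zero, one_pow] using h
  have hQ1' : HasMaj (BlockNorm.ofBlocks (unitTorusGeo L k M) (liftBlk (fun b : Tor M × Fin (d + 1) => b.1) ι))
      (BlockNorm.ofBlocks (unitTorusGeo L k M) (liftBlk (fun b : Tor (fine (L ^ m * L ^ k) M) × Fin (d + 1) => blockOf (L ^ m * L ^ k) M b.1) ι))
      (qvCovAdj M (L ^ m * L ^ k) (fun _ _ => (1 : Matrix ι ι ℝ))) (fun y y' => 1 * Real.exp (2 * δ) * Real.exp (-(2 * δ * tdistT M y y'))) := by
    have h := hasMaj_qvCovAdj (L := L) M k (L ^ m * L ^ k) (T := fun _ _ => (1 : Matrix ι ι ℝ)) (ρ := 0) le_rfl h2δ (fun μ p j => by simp)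
    simpa only [add_zero, one_pow] using h
  have hQT : HasMaj (BlockNorm.ofBlocks (unitTorusGeo L k M) (liftBlk (fun b : Tor (fine (L ^ k) M) × Fin (d + 1) => blockOf (L ^ k) M b.1) ι))
      (BlockNorm.ofBlocks (unitTorusGeo L k M) (liftBlk (fun b : Tor M × Fin (d + 1) => b.1) ι))
      (qvKer M (L ^ k) W) (fun y y' => (1 + K) * Real.exp δ * Real.exp (-(δ * tdistT M y y'))) :=
    hasMaj_qvKer M k (L ^ k) (by positivity) hδ.le fun p s hs i => hWr p s hs.le i
  have hQT' : HasMaj (BlockNorm.ofBlocks (unitTorusGeo L k M) (liftBlk (fun b : Tor M × Fin (d + 1) => b.1) ι))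
      (BlockNorm.ofBlocks (unitTorusGeo L k M) (liftBlk (fun b : Tor (fine (L ^ m * L ^ k) M) × Fin (d + 1) => blockOf (L ^ m * L ^ k) M b.1) ι))
      (qvAdjKer M (L ^ m * L ^ k) W') (fun y y' => (1 + K') * Real.exp (2 * δ) * Real.exp (-(2 * δ * tdistT M y y'))) :=
    hasMaj_qvAdjKer M k (L ^ m * L ^ k) (by positivity) h2δ fun p s hs c' => hW'c p s hs.le c'
  -- the four compositions through the unit lattice
  have hW1 := hasMaj_comp_exp (ρ₁ := 2 * δ) (ρ₂ := δ) (ρ := δ) (σ := δ) (triangle254_unitTorusGeo L k M) (unitTorusGeo_dist_nonneg L k M) hrow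
    (by positivity) (mul_nonneg hn0 (Real.exp_nonneg _)) hδ.le le_rfl (by linarith) hQ1' hD1
  have hW2 := hasMaj_comp_exp (ρ₁ := 2 * δ) (ρ₂ := δ) (ρ := δ) (σ := δ) (triangle254_unitTorusGeo L k M) (unitTorusGeo_dist_nonneg L k M) hrow
    (mul_nonneg hn0 (Real.exp_nonneg _)) (by positivity) hδ.le le_rfl (by linarith) hD2 hQ1
  have hW3 := hasMaj_comp_exp (ρ₁ := 2 * δ) (ρ₂ := δ) (ρ := δ) (σ := δ) (triangle254_unitTorusGeo L k M) (unitTorusGeo_dist_nonneg L k M) hrow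
    (mul_nonneg (by linarith) (Real.exp_nonneg _)) (mul_nonneg hB (Real.exp_nonneg _)) hδ.le le_rfl (by linarith) hQT' hD3
  have hW4 := hasMaj_comp_exp (ρ₁ := 2 * δ) (ρ₂ := δ) (ρ := δ) (σ := δ) (triangle254_unitTorusGeo L k M) (unitTorusGeo_dist_nonneg L k M) hrow
    (mul_nonneg hB (Real.exp_nonneg _)) (mul_nonneg (by linarith) (Real.exp_nonneg _)) hδ.le le_rfl (by linarith) hD4 hQT
  have hκ : (BlockNorm.ofBlocks (unitTorusGeo L k M) (liftBlk (fun b : Tor M × Fin (d + 1) => b.1) ι)).κ = 1 := rfl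
  refine (hasMaj_smul_ofBlocks _ (fun y y' => ?_) a ((hW1.add hW2).sub (hW3.add hW4))).mono fun y y' => ?_
  · rw [hκ]
    positivity
  · rw [hκ]
    have he : Real.exp (3 * δ) = Real.exp (2 * δ) * Real.exp δ := by rw [← Real.exp_add]; ring_nf
    rw [he]
    apply le_of_eq
    simp only [one_mul]
    ring

end Defect

end Summit.QuantumFields.YangMills.BalabanUVNodes.N15.CovAvg

end
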